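import Summits.ResolutionOfSingularities.ResolutionOfSingularities.Theorems.UniversalCellsCampaignW82ClimbKernelGraded
import Literature.AlgebraicGeometry.Resolution.InseparableLocalUniformizationDefect
import Literature.AlgebraicGeometry.Resolution.ResolutionOfComponents
import Mathlib.RingTheory.AlgebraicIndependent.Basic
import Mathlib.FieldTheory.IntermediateField.Adjoin.Defs
import HarnessLib

/-!
# [OURS · L1 W8.2] The FINITE-LEVEL graded family transfer and the perfection step of slot W8.2
# (rung B, prime-field / family transfer) — campaign statements, Theses-free module

Cell `res-hironaka` (run/shared/lean/pub/res-hironaka/), LADDER-RESOLUTION rung L (RESCUE), slot W8.2 of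
plan/RESCUE-SEED.md («PRIME-FIELD / UNIVERSALITY TRANSFER instead of descent»), host route `UniversalCells`,
host item `PrimeFieldToPerfect` (stmt-ResolutionOfSingularities-15233); second door `UniformComplexity`
`PrimeModelTransfer` (stmt-ResolutionOfSingularities-8933). Statement-only file (typer res-L1-type-o6,
statement-only lane; two-lane rule: the slot's provers res-L1-s82-pv-1 / pv-2 prove AGAINST these names in
their own Theorems files): five OURS `Prop`s and six pure-logic anchors; NOTHING is proved about resolution
of singularities here and nothing is asserted.

WHY THIS FILE. The dimension-graded climb kernel `CampaignW82.ClimbRatFuncPerfDimLe p m n`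
(Theorems/UniversalCellsCampaignW82ClimbKernelGraded.lean, p466046) goes from a PERFECT constant field `M`
(resolution in dimension `≤ m`) to the PERFECT field `M(t)^{perf}` (resolution in dimension `≤ n`). It factors
— by pure logic, `climbRatFuncPerfDimLe_of_spreadOut_of_perfectionStep` below — through the FINITE level
`RatFunc M = M(t)`:

* FINITE-LEVEL FAMILY TRANSFER `SpreadOutRatFuncDimLe p m n` (resolution over `M` in dimension `≤ m` ⇒
  resolution over `RatFunc M` in dimension `≤ n`): the mechanism of the landed half (a)
  `Theorems.PrimeFieldToPerfect.stub_spreadOut` (p149455) / `CampaignW82.primeToFg_holds` (p463015) — spread a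
  `RatFunc M`-scheme out to a model over a finitely generated `M`-subalgebra `R ⊆ RatFunc M` with
  `Frac R = RatFunc M`, resolve the total space over `M`, pass to the generic fibre (no base FIELD extension,
  so no regular-versus-smooth issue) — WITH DIMENSION BOOKKEEPING: the total space of a model over a curve has
  dimension `≤ n + 1` (tree: `Literature.AlgebraicGeometry.CossartPiltant200819.CP2019.topologicalKrullDim_le_of_isPullback_genericFibre`
  and `…_of_genericFibre`, files Rem41GenericFibreDimension2019.lean / Cor13IntegralModels2019.lean, Matsumura
  Thm. 15.5; below abbreviated `CP2019.…`, and `CP2008.…` for the sibling namespace of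
  Cor46Cofinality2008.lean). Rung `(n + 1, n)` for every `n` — packaged as the single
  theorem-to-prove `FamilyTransferSucc p` — is what res-L1-s82-pv-1 announced (STATUS 2026-08-26T20:38:07Z
  (iii) «GRADED FINITE-LEVEL FAMILY TRANSFER … Res over perfect M in dim ≤ n+1 ⇒ Res over RatFunc M in dim
  ≤ n»); it is «the regular-total-space transfer that the (5, 4) remark of p466046 presupposes».
* Its faithful general form `SpreadOutFgFieldDimLe p d m n` — FINITELY GENERATED field extensions `K / M`
  of transcendence degree `≤ d`, rung `(d, n + d, n)`, packaged as `FgFieldTransferShift p` — is the graded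
  replacement of the printed device «transcendence degree d … dimension d + dim Z» (below); `d = 1`,
  `K = RatFunc M` recovers the first bullet (`spreadOutRatFuncDimLe_of_fgField`, using the tree lemmas
  `Resolution.ratFunc_adjoin_X_eq_top` / `Resolution.trdeg_ratFunc_le_one`).
* PERFECTION STEP `PerfectionStepDimLe p n` (resolution over `RatFunc M` in dimension `≤ n`, `M` perfect ⇒
  resolution over every perfect purely inseparable extension `L ⊇ RatFunc M`, i.e. `L ≅ M(t)^{perf}`, in
  dimension `≤ n`): the slot's HONEST RESIDUAL at grade `n` — exactly where the transport barriers bite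
  (a resolution at a finite level `M(t^{1/p^e}) ≅ RatFunc M` is a REGULAR model, which need not stay regular
  over `L`). Open-problem grade for `n ≥ 4` like the kernel; a theorem for `n ≤ 3` (Cossart–Piltant over the
  excellent `X_L`, FACT-LIST F-02, hypothesis unused).

BUILD RULE (cell, director-resolution 2026-08-26T18:53:29Z (B)): OURS vocabulary file, THESES-FREE BY BIRTH —
imports only the Theses-free graded-kernel module (p466046), Mathlib, one `Literature.…Resolution` module
(for the two `RatFunc` lemmas of the `d = 1` anchor) and `HarnessLib`.

HONEST FRAMING. The `def`s below are OURS — campaign statements that REPLACE THE ROLE of a printed item of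
H. Hironaka's manuscript *Resolution of singularities in positive characteristics* (2017-03-23,
[Hironaka2017], lit key `paper:url-3343fd9e678b`; PDF page = printed page, `l.` = line of the page text
file) — namely §17 ¶2, p.89 l.59–62: «In this work the base field K is always assumed to be a finite field
or Z/pZ because our resolution is for all dimension. When the K has transcendence degree d we can
reformulate the resolution problem to the case of dimension d + dim Z.» (typed AS PRINTED, not asserted, as
`Literature.AlgebraicGeometry.Hironaka2017.S17Methodology.U89_3`, and under the §2 p.4 l.22–24 reading
«a perfect base field K» as `U89_3_ours`). The printed sentence puts NO finite-generation condition on `K`;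
at `d = 1` it therefore covers both `K = 𝔽_p(t)` (finitely generated: the finite level, where spreading out
works — `SpreadOutFgFieldDimLe`) and `K = 𝔽_p(t)^{perf}` (transcendence degree 1, perfect, NOT finitely
generated: the perfection step `PerfectionStepDimLe`, where the barriers live). Separating the two is the
point of this file. NOT statements of the manuscript; nothing here is attributed to its author; no typed
candidate of the manuscript is used even as a hypothesis. AI transcription, weaker than expert review.

CONTENT (non-embedded summit idiom `Scheme.HasResolution`, integral separated schemes of finite type,
ground field passed explicitly as `f : X ⟶ Spec K`, dimension = `topologicalKrullDim` of the carrier with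
values in `WithBot ℕ∞`, grades as in `ClimbRatFuncPerfDimLe`; transcendence degree = Mathlib
`Algebra.trdeg : Cardinal`; «finitely generated as a field over `M`» = Mathlib `IntermediateField.FG ⊤`):

* `SpreadOutRatFuncDimLe p m n`, `SpreadOutFgFieldDimLe p d m n`, `PerfectionStepDimLe p n` — the three
  graded `Prop`s above;
* `FamilyTransferSucc p := ∀ n, SpreadOutRatFuncDimLe p (n + 1) n` and
  `FgFieldTransferShift p := ∀ d n, SpreadOutFgFieldDimLe p d (n + d) n` — the two THEOREMS-TO-PROVE of the
  slot's provers (names fixed here; proofs land in their files as `familyTransferSucc_holds` etc.);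
* anchors (pure logic, plus the two cited `RatFunc` lemmas in one of them): `spreadOutRatFuncDimLe_mono`,
  `spreadOutFgFieldDimLe_mono`, `spreadOutRatFuncDimLe_of_fgField` (`d = 1`, `K = RatFunc M`),
  `familyTransferSucc_of_fgFieldTransferShift`, `spreadOutRatFuncDimLe_top_of_familyTransferSucc`
  (`n = ⊤`: the ungraded finite-level transfer), `climbRatFuncPerfDimLe_of_spreadOut_of_perfectionStep`
  (THE FACTORISATION: kernel grade `(m, n)` ⇐ finite level `(m, n)` ∧ perfection step `n`).

RUNGS (for res-L1-s82-pv-1 / pv-2; recorded, NOT proved here): `SpreadOutFgFieldDimLe p 0 n n` (finite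
extensions: `X → Spec K → Spec M` is again separated of finite type, same carrier — sanity rung);
`FamilyTransferSucc p` and `FgFieldTransferShift p` (spreading out + Matsumura 15.5 — bankable now,
unconditionally; for `d = 1` over the Dedekind base `M[t][1/g]` the tree's
`CP2019.topologicalKrullDim_le_of_isPullback_genericFibre` is the dimension count, for general `d` the ring-level
`Resolution.height_le_height_add_trdeg` with `CP2008.ringKrullDim_eq_of_fg_of_trdeg_eq`);
`PerfectionStepDimLe p n` for `n ≤ 3` from F-02 (conditional on the named fact only); `PerfectionStepDimLe p 4`
is the first open rung of the slot (K8.2 §4's «second, disjoint check», now isolated from the family transfer).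

BARRIERS (catalogued under `Literature/Barriers/ResolutionOfSingularities/`, namespace
`Literature.Barriers.ResolutionOfSingularities`): the finite-level transfers `SpreadOut…` involve NO base
field extension and meet none of them (they end with a REGULAR model over the finitely generated field, which
is all a resolution asks); the perfection step is bounded, for `n ≥ 4`, exactly as the kernel is, by file
`RegularNotGeometricallyRegular.lean` (regular over `RatFunc M` ≠ regular after `t ↦ t^{1/p}`), file
`FrobeniusTwistResolution.lean` decl `not_hasResolution_Spec_frobTwist`, file
`InseparableBaseChangeResolution.lean` decls `not_hasResolution_Spec_dualNumber` /
`not_hasResolution_pullback_extField` (no transport of `Scheme.HasResolution` along `K → K^{1/p}`). The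
factorisation does not evade them; it puts everything provable on one side of them.

VACUITY SELF-CHECK (one line per decl in the docstrings): for prime `p` none of the five `Prop`s is trivially
false (each instance follows from the summit statement `ResolutionInChar p`, the conclusions being resolution
statements in characteristic `p`); `SpreadOut…` / `PerfectionStep…` are trivially true exactly at `n = ⊥`
(integral schemes are nonempty) and NOT trivially true at `m = ⊥` (the hypothesis is then idle and the
conclusion is resolution over `RatFunc M` outright); the two theorems-to-prove are honest theorems (neither
hypothesis-free nor instances of their hypotheses: the ground field changes). For composite `p > 1` there is
no field of characteristic `p` (vacuous); `p = 0` is characteristic zero and not intended.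

## References (vocabulary and locators only; nothing cited as a premise)
* H. Hironaka, ms. 2017-03-23, §17 ¶2 p.89 l.59–62; §2 p.4 l.22–24 — under adjudication, quoted for the
  role replaced, not asserted. [Hironaka2017]
* H. Matsumura, *Commutative Ring Theory*, Thm. 15.5 (dimension inequality) — the tool behind the rungs, not
  used in this file. [Matsumura1987]
* A. Grothendieck, J. Dieudonné, EGA IV₃, Thm. 8.8.2 (ii) (spreading out) — idem. [EGAIV3]
* V. Cossart, O. Piltant, J. Algebra 529 (2019), Thm. 1.1 — the named fact F-02 behind `n ≤ 3` (not used
  here). [CossartPiltant2019]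
* L/res-L1-k82/KILL-TEST-K8.2.md §4; plan/RESCUE-SEED.md row W8.2; L/SLOTS.md §2 W8.2 — cell files, OURS.
-/

noncomputable section

set_option linter.dupNamespace false -- mandated namespace of this single-conjunct summit

open _root_.CategoryTheory _root_.AlgebraicGeometry
open Literature.AlgebraicGeometry.Resolution

namespace Summit.ResolutionOfSingularities.ResolutionOfSingularities.Theorems.CampaignW82

/-! ## The finite-level graded family transfer (one transcendental: `RatFunc M`) -/

/-- [OURS · L1 W8.2] replaces the role of §17 ¶2, p.89 l.60–62 («When the K has transcendence degree d we can
reformulate the resolution problem to the case of dimension d + dim Z»; typed as `S17Methodology.U89_3` /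
`U89_3_ours`) at transcendence degree ONE and at the FINITE level `K = M(t)`, GRADED BY DIMENSION, in the
non-embedded summit idiom; NOT a statement of the manuscript.
THE FINITE-LEVEL FAMILY TRANSFER at `p` with bounds `(m, n)`: for every field `M` of characteristic `p`
(perfectness is NOT assumed — the mechanism makes no base field extension) over which every integral
separated `M`-scheme of finite type of topological Krull dimension `≤ m` has a resolution
(`Scheme.HasResolution`), every integral separated scheme of finite type of dimension `≤ n` over the rational
function field `RatFunc M` has a resolution. Intended proof of the rung `(n + 1, n)` (`FamilyTransferSucc`,
for the slot's provers, not given here): spread `X` out to an integral model `𝒳 → Spec R`, `R ⊆ RatFunc M` a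
finitely generated `M`-subalgebra containing `t` with `Frac R = RatFunc M` (which one may enlarge to a
localisation `M[t][1/g]`, a Dedekind domain), so that `dim 𝒳 ≤ n + 1`
(`CP2019.topologicalKrullDim_le_of_isPullback_genericFibre`);
resolve `𝒳` over `M`; the generic fibre of that resolution resolves `X`
(`Theorems.hasResolution_pullback_of_flat_of_surjectiveOnStalks`). Monotone in `m`, antitone in `n`
(`spreadOutRatFuncDimLe_mono`); the case `d = 1`, `K = RatFunc M` of `SpreadOutFgFieldDimLe`
(`spreadOutRatFuncDimLe_of_fgField`). Vacuity (prime `p`): trivially true only at `n = ⊥` (integral schemes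
are nonempty); at `m = ⊥` the hypothesis is idle and the statement is resolution over `RatFunc M` in
dimension `≤ n` outright (open for `n ≥ 4`); never trivially false (every instance follows from
`ResolutionInChar p`); composite `p > 1` admits no field of characteristic `p` (vacuous). [folklore] -/
def SpreadOutRatFuncDimLe (p : ℕ) (m n : WithBot ℕ∞) : Prop :=
  ∀ (M : Type) [Field M] [CharP M p],
    (∀ (X : Scheme.{0}) (f : X ⟶ Spec (.of M)),
        IsSeparated f → LocallyOfFiniteType f → QuasiCompact f → IsIntegral X →
          topologicalKrullDim X ≤ m → Scheme.HasResolution X) →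
      ∀ (X : Scheme.{0}) (f : X ⟶ Spec (.of (RatFunc M))),
        IsSeparated f → LocallyOfFiniteType f → QuasiCompact f → IsIntegral X →
          topologicalKrullDim X ≤ n → Scheme.HasResolution X

/-! ## The finite-level graded family transfer (finitely generated fields of transcendence degree `≤ d`) -/

/-- [OURS · L1 W8.2] replaces the role of §17 ¶2, p.89 l.60–62 («When the K has transcendence degree d we can
reformulate the resolution problem to the case of dimension d + dim Z»; typed as `S17Methodology.U89_3` /
`U89_3_ours`) for FINITELY GENERATED fields `K` over an arbitrary constant field `M` of characteristic `p`
(the printed base is «a finite field or Z/pZ», p.89 l.59–60, and the printed sentence has NO finite-generation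
condition — see `PerfectionStepDimLe` for what that omission hides), GRADED BY DIMENSION, in the
non-embedded summit idiom; NOT a statement of the manuscript.
THE FINITE-LEVEL FIELD TRANSFER at `p` with transcendence bound `d` and dimension bounds `(m, n)`: for every
field `M` of characteristic `p` over which every integral separated `M`-scheme of finite type of dimension
`≤ m` has a resolution, and every field `K ⊇ M` FINITELY GENERATED over `M` as a field
(`(⊤ : IntermediateField M K).FG`) with `Algebra.trdeg M K ≤ d`, every integral separated `K`-scheme of
finite type of dimension `≤ n` has a resolution. Intended proof of the rung `(d, n + d, n)`
(`FgFieldTransferShift`, for the slot's provers, not given here): a model over a finitely generated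
`M`-subalgebra `R ⊆ K` with `Frac R = K` has dimension `≤ n + dim R = n + tr.deg_M K ≤ n + d` (dimension
inequality, Matsumura Thm. 15.5, tree `Resolution.height_le_height_add_trdeg`; `dim R = tr.deg`, tree
`CP2008.ringKrullDim_eq_of_fg_of_trdeg_eq`); resolve it over `M` and take the generic fibre. Rung
`(0, n, n)` (finite extensions) is the sanity check. Antitone in `d` and `n`, monotone in `m`
(`spreadOutFgFieldDimLe_mono`). Vacuity (prime `p`): trivially true only at `n = ⊥`; at `m = ⊥` it asserts
resolution over every finitely generated field of transcendence degree `≤ d` outright (open for `n ≥ 4`);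
never trivially false (follows from `ResolutionInChar p`: `K` has characteristic `p`); composite `p > 1`
vacuous. [folklore] -/
def SpreadOutFgFieldDimLe (p : ℕ) (d : ℕ) (m n : WithBot ℕ∞) : Prop :=
  ∀ (M : Type) [Field M] [CharP M p],
    (∀ (X : Scheme.{0}) (f : X ⟶ Spec (.of M)),
        IsSeparated f → LocallyOfFiniteType f → QuasiCompact f → IsIntegral X →
          topologicalKrullDim X ≤ m → Scheme.HasResolution X) →
      ∀ (K : Type) [Field K] [Algebra M K],
        (⊤ : IntermediateField M K).FG → Algebra.trdeg M K ≤ d →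
          ∀ (X : Scheme.{0}) (f : X ⟶ Spec (.of K)),
            IsSeparated f → LocallyOfFiniteType f → QuasiCompact f → IsIntegral X →
              topologicalKrullDim X ≤ n → Scheme.HasResolution X

/-! ## The perfection step (the honest residual at grade `n`) -/

/-- [OURS · L1 W8.2] replaces the role of §17 ¶2, p.89 l.60–62 read with §2 p.4 l.22–24 («a perfect base field
K»; typed as `S17Methodology.U89_3_ours`) at transcendence degree one for the target field `K = M(t)^{perf}`
— perfect, of transcendence degree `1` over `M`, NOT finitely generated — ISOLATED from the finite-level
transfer and GRADED BY DIMENSION, in the non-embedded summit idiom; NOT a statement of the manuscript.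
THE PERFECTION STEP at `p`, grade `n`: for every PERFECT field `M` of characteristic `p` such that every
integral separated scheme of finite type of dimension `≤ n` over `RatFunc M` has a resolution, every integral
separated scheme of finite type of dimension `≤ n` over every PERFECT field `L` purely inseparable over
`RatFunc M` (i.e. `L ≅ M(t)^{perf}`; `M` perfect makes every finite level `M(t^{1/p^e}) ⊆ L` isomorphic to
`RatFunc M`, which is why the hypothesis is stated over `RatFunc M` alone) has a resolution. This is the
slot's honest residual: the hypothesis supplies REGULAR models at every finite level, the conclusion needs a
model that is SMOOTH at some finite level (`Theorems.PrimeFieldToPerfect.stub_limitDescent`), and «regular ⇒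
geometrically regular» fails over `RatFunc M` (barrier files `RegularNotGeometricallyRegular.lean`,
`InseparableBaseChangeResolution.lean`, `FrobeniusTwistResolution.lean`). With `SpreadOutRatFuncDimLe p m n`
it gives the kernel grade `ClimbRatFuncPerfDimLe p m n` (`climbRatFuncPerfDimLe_of_spreadOut_of_perfectionStep`,
pure logic). Rungs (not proved here): `n ≤ 3` from the named fact `CossartPiltant2019` (F-02; hypothesis
unused); `n = 4` is the first open rung of slot W8.2. Vacuity (prime `p`): trivially true only at `n = ⊥`;
never trivially false (follows from `ResolutionInChar p`); NOT monotone in `n` (hypothesis and conclusion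
move together); composite `p > 1` vacuous. [folklore] -/
def PerfectionStepDimLe (p : ℕ) (n : WithBot ℕ∞) : Prop :=
  ∀ (M : Type) [Field M] [CharP M p] [PerfectField M],
    (∀ (X : Scheme.{0}) (f : X ⟶ Spec (.of (RatFunc M))),
        IsSeparated f → LocallyOfFiniteType f → QuasiCompact f → IsIntegral X →
          topologicalKrullDim X ≤ n → Scheme.HasResolution X) →
      ∀ (L : Type) [Field L] [PerfectField L] [Algebra (RatFunc M) L] [IsPurelyInseparable (RatFunc M) L]
        (X : Scheme.{0}) (f : X ⟶ Spec (.of L)),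
        IsSeparated f → LocallyOfFiniteType f → QuasiCompact f → IsIntegral X →
          topologicalKrullDim X ≤ n → Scheme.HasResolution X

/-! ## The two theorems-to-prove of the slot's provers (names fixed here, proofs elsewhere) -/

/-- [OURS · L1 W8.2] replaces the role of §17 ¶2, p.89 l.60–62 at transcendence degree one, finite level, as
the slot's FIRST THEOREM-TO-PROVE (announced by res-L1-s82-pv-1, STATUS 2026-08-26T20:38:07Z (iii)); NOT a
statement of the manuscript. THE FAMILY TRANSFER, ONE TRANSCENDENTAL: for every dimension bound `n`, resolution
of integral separated schemes of finite type of dimension `≤ n + 1` over a field `M` of characteristic `p`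
implies resolution of those of dimension `≤ n` over `RatFunc M` — `SpreadOutRatFuncDimLe p (n + 1) n` for all
`n : WithBot ℕ∞` (`n = ⊤`: the ungraded transfer, `spreadOutRatFuncDimLe_top_of_familyTransferSucc`; `n = ⊥`:
trivial). Expected proof: spreading out over the Dedekind domain `M[t][1/g]` + the tree's
`CP2019.topologicalKrullDim_le_of_isPullback_genericFibre` + generic fibre of a resolution, as for the landed
`Theorems.PrimeFieldToPerfect.stub_spreadOut`. A consequence of `FgFieldTransferShift p`
(`familyTransferSucc_of_fgFieldTransferShift`). Vacuity (prime `p`): an honest theorem — not hypothesis-free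
(its instances at `n ≥ 4` contain open resolution statements on both sides) and not an instance of its
hypothesis (the ground field changes from `M` to `RatFunc M`); never trivially false (follows from
`ResolutionInChar p`); composite `p > 1` vacuous. [folklore] -/
def FamilyTransferSucc (p : ℕ) : Prop :=
  ∀ n : WithBot ℕ∞, SpreadOutRatFuncDimLe p (n + 1) n

/-- [OURS · L1 W8.2] replaces the role of §17 ¶2, p.89 l.60–62 («transcendence degree d … dimension
d + dim Z») for finitely generated fields, as the slot's SECOND THEOREM-TO-PROVE — the faithful graded form of
the printed device; NOT a statement of the manuscript. THE FIELD TRANSFER WITH SHIFT `d`: for every `d : ℕ`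
and every dimension bound `n`, resolution of integral separated schemes of finite type of dimension
`≤ n + d` over a field `M` of characteristic `p` implies resolution of those of dimension `≤ n` over every
field `K` finitely generated over `M` of transcendence degree `≤ d` — `SpreadOutFgFieldDimLe p d (n + d) n`
for all `d`, `n`. Expected proof: spreading out over a finitely generated `M`-subalgebra `R ⊆ K` with
`Frac R = K` + the dimension inequality (Matsumura Thm. 15.5, tree `Resolution.height_le_height_add_trdeg`)
+ generic fibre of a resolution. Implies `FamilyTransferSucc p` (`d = 1`, `K = RatFunc M`). Vacuity (prime
`p`): an honest theorem as for `FamilyTransferSucc`; `d = 0` (finite extensions `K / M`) is its easy but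
non-vacuous instance; never trivially false; composite `p > 1` vacuous. [folklore] -/
def FgFieldTransferShift (p : ℕ) : Prop :=
  ∀ (d : ℕ) (n : WithBot ℕ∞), SpreadOutFgFieldDimLe p d (n + d) n

/-! ## Pure-logic anchors -/

/-- **Monotonicity of the finite-level family transfer** (pure logic): `SpreadOutRatFuncDimLe p m n →
SpreadOutRatFuncDimLe p m' n'` whenever `m ≤ m'` and `n' ≤ n`. [folklore] -/
theorem spreadOutRatFuncDimLe_mono {p : ℕ} {m m' n n' : WithBot ℕ∞} (hm : m ≤ m') (hn : n' ≤ n)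
    (h : SpreadOutRatFuncDimLe p m n) : SpreadOutRatFuncDimLe p m' n' :=
  fun M _ _ hM X f hs hl hq hX hd =>
    h M (fun Y g hs' hl' hq' hY hdY => hM Y g hs' hl' hq' hY (hdY.trans hm)) X f hs hl hq hX
      (hd.trans hn)

/-- **Monotonicity of the finite-level field transfer** (pure logic): `SpreadOutFgFieldDimLe p d m n →
SpreadOutFgFieldDimLe p d' m' n'` whenever `d' ≤ d`, `m ≤ m'` and `n' ≤ n`. [folklore] -/
theorem spreadOutFgFieldDimLe_mono {p d d' : ℕ} {m m' n n' : WithBot ℕ∞} (hd : d' ≤ d) (hm : m ≤ m')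
    (hn : n' ≤ n) (h : SpreadOutFgFieldDimLe p d m n) : SpreadOutFgFieldDimLe p d' m' n' :=
  fun M _ _ hM K _ _ hfg htr X f hs hl hq hX hdim =>
    h M (fun Y g hs' hl' hq' hY hdY => hM Y g hs' hl' hq' hY (hdY.trans hm)) K hfg
      (htr.trans (by exact_mod_cast hd)) X f hs hl hq hX (hdim.trans hn)

/-- **One transcendental is the case `d = 1`, `K = RatFunc M`** of the field transfer: `RatFunc M = M(t)` is
generated over `M` by `t` (`Resolution.ratFunc_adjoin_X_eq_top`) and has transcendence degree `≤ 1`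
(`Resolution.trdeg_ratFunc_le_one`); the rest is instantiation. [folklore] -/
theorem spreadOutRatFuncDimLe_of_fgField {p : ℕ} {m n : WithBot ℕ∞} (h : SpreadOutFgFieldDimLe p 1 m n) :
    SpreadOutRatFuncDimLe p m n :=
  fun M _ _ hM X f hs hl hq hX hd =>
    h M hM (RatFunc M) ⟨{RatFunc.X}, by simpa using ratFunc_adjoin_X_eq_top M⟩
      (by simpa using trdeg_ratFunc_le_one M) X f hs hl hq hX hd

/-- Hence the second theorem-to-prove implies the first (`d = 1`, `K = RatFunc M`; pure logic after
`spreadOutRatFuncDimLe_of_fgField`). [folklore] -/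
theorem familyTransferSucc_of_fgFieldTransferShift {p : ℕ} (h : FgFieldTransferShift p) :
    FamilyTransferSucc p :=
  fun n => spreadOutRatFuncDimLe_of_fgField (by simpa only [Nat.cast_one] using h 1 n)

/-- **The ungraded finite-level transfer** is the grade `n = ⊤` of the first theorem-to-prove (pure logic,
`le_top`): resolution of ALL integral separated schemes of finite type over `M` ⇒ the same over `RatFunc M`
— the statement `Theorems.PrimeFieldToPerfect.stub_spreadOut` proves with `𝔽_p` in place of `M`. [folklore] -/
theorem spreadOutRatFuncDimLe_top_of_familyTransferSucc {p : ℕ} (h : FamilyTransferSucc p) :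
    SpreadOutRatFuncDimLe p ⊤ ⊤ :=
  spreadOutRatFuncDimLe_mono le_top le_rfl (h ⊤)

/-- **THE FACTORISATION OF THE GRADED KERNEL** (pure logic): the finite-level family transfer at `(m, n)`
and the perfection step at grade `n` together give the kernel grade `ClimbRatFuncPerfDimLe p m n` of
Theorems/UniversalCellsCampaignW82ClimbKernelGraded.lean (p466046) — given a perfect `M` with resolution in
dimension `≤ m`, the first yields resolution over `RatFunc M` in dimension `≤ n`, which is the hypothesis of
the second. With `FamilyTransferSucc p` this reads: `PerfectionStepDimLe p n → ClimbRatFuncPerfDimLe p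
(n + 1) n`; in particular the first open kernel rung `(5, 4)` (equivalently `(⊤, 4)`) is reduced to the
perfection step at grade `4`. [folklore] -/
theorem climbRatFuncPerfDimLe_of_spreadOut_of_perfectionStep {p : ℕ} {m n : WithBot ℕ∞}
    (h₁ : SpreadOutRatFuncDimLe p m n) (h₂ : PerfectionStepDimLe p n) : ClimbRatFuncPerfDimLe p m n :=
  fun M _ _ _ hM L _ _ _ _ X f hs hl hq hX hd =>
    h₂ M (fun Y g hs' hl' hq' hY hdY => h₁ M hM Y g hs' hl' hq' hY hdY) L X f hs hl hq hX hd

/-! ## v2 (append-only): ℕ-indexed packaging against the tree predicate `IntegralResolutionOverUpToDim`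

Everything above this line is byte-identical with v1 (p469608, sha16 0b94b2348ac31915; OURS-DESK #27: lane A 11/11
res-L1-ref-a1 2026-08-26T22:26:27Z). Appended by res-L1-type-o6. PROVENANCE. The slot's prover res-L1-s82-pv-1 builds
the finite-level family transfer (HOME/STATUS.md 2026-08-26T21:47:47Z) in the vocabulary of the tree predicate
`Literature.AlgebraicGeometry.Resolution.IntegralResolutionOverUpToDim k d` (`ResolutionOfComponents.lean`: every
integral separated `k`-scheme of finite type of dimension `≤ d` has a resolution; `d : ℕ`) — «`IntegralResolutionOverUpToDim
k (n+d) → IntegralResolutionOverUpToDim K n` for `K = Frac A`, `A` a finitely generated `k`-domain of dimension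
`≤ d`», dimension half landed as p470002 `Literature/AlgebraicGeometry/Dimension/GenericFibreDimensionBound.lean`. At
FINITE grades the hypothesis and conclusion blocks of v1's `SpreadOutFgFieldDimLe` / `SpreadOutRatFuncDimLe` ARE that
predicate, binder for binder (`spreadOutFgFieldDimLe_natCast_iff`, `Iff.rfl`); this section fixes the ℕ-indexed names
`FgFieldTransferShiftNat p` / `FamilyTransferSuccNat p` a prover working with `d n : ℕ` closes directly, and wires them
to v1 by pure logic (the `WithBot ℕ∞`-indexed v1 theorems-to-prove imply them: `Nat.cast_add`; conversely they give
v1's statements at every finite grade, the grades `⊥` being trivial and `⊤` the ungraded transfer). Same honest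
framing, build rule and barriers as v1; one more Theses-free import (`…Resolution.ResolutionOfComponents`). -/

/-- [OURS · L1 W8.2] replaces the role of §17 ¶2, p.89 l.60–62 («transcendence degree d … dimension d + dim Z») for
finitely generated fields, ℕ-INDEXED and stated with the tree predicate `IntegralResolutionOverUpToDim`; NOT a statement
of the manuscript. For all `d n : ℕ`: if every integral separated scheme of finite type of dimension `≤ n + d` over a
field `M` of characteristic `p` has a resolution, then so does every integral separated scheme of finite type of
dimension `≤ n` over every field `K` finitely generated over `M` with `Algebra.trdeg M K ≤ d`. Literally
`∀ d n, SpreadOutFgFieldDimLe p d ↑(n + d) ↑n` (`fgFieldTransferShiftNat_iff`, `Iff.rfl`); implied by v1's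
`FgFieldTransferShift p` (`fgFieldTransferShiftNat_of_fgFieldTransferShift`). Vacuity (prime `p`): an honest theorem
(both sides are open resolution statements for `n ≥ 4`; the ground field changes); `d = 0` = finite extensions (easy,
non-vacuous); never trivially false; composite `p > 1` vacuous. [folklore] -/
def FgFieldTransferShiftNat (p : ℕ) : Prop :=
  ∀ (d n : ℕ) (M : Type) [Field M] [CharP M p], IntegralResolutionOverUpToDim.{0} M (n + d) →
    ∀ (K : Type) [Field K] [Algebra M K], (⊤ : IntermediateField M K).FG → Algebra.trdeg M K ≤ d →
      IntegralResolutionOverUpToDim.{0} K n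

/-- [OURS · L1 W8.2] replaces the role of §17 ¶2, p.89 l.60–62 at transcendence degree one, finite level,
ℕ-INDEXED and stated with the tree predicate `IntegralResolutionOverUpToDim`; NOT a statement of the manuscript. For
all `n : ℕ`: resolution of integral separated schemes of finite type of dimension `≤ n + 1` over a field `M` of
characteristic `p` implies the same in dimension `≤ n` over `RatFunc M`. Literally `∀ n, SpreadOutRatFuncDimLe p
↑(n + 1) ↑n` (`familyTransferSuccNat_iff`, `Iff.rfl`); implied by v1's `FamilyTransferSucc p` and by
`FgFieldTransferShiftNat p` (`d = 1`). Vacuity (prime `p`): an honest theorem as above; never trivially false;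
composite `p > 1` vacuous. [folklore] -/
def FamilyTransferSuccNat (p : ℕ) : Prop :=
  ∀ (n : ℕ) (M : Type) [Field M] [CharP M p], IntegralResolutionOverUpToDim.{0} M (n + 1) →
    IntegralResolutionOverUpToDim.{0} (RatFunc M) n

/-- **At finite grades the v1 blocks are the tree predicate** (definitional, `Iff.rfl`): `SpreadOutFgFieldDimLe p d
↑(n + d) ↑n` unfolds to the `IntegralResolutionOverUpToDim` form. [folklore] -/
theorem spreadOutFgFieldDimLe_natCast_iff (p d n : ℕ) :
    SpreadOutFgFieldDimLe p d ((n + d : ℕ) : WithBot ℕ∞) (n : WithBot ℕ∞) ↔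
      ∀ (M : Type) [Field M] [CharP M p], IntegralResolutionOverUpToDim.{0} M (n + d) →
        ∀ (K : Type) [Field K] [Algebra M K], (⊤ : IntermediateField M K).FG → Algebra.trdeg M K ≤ d →
          IntegralResolutionOverUpToDim.{0} K n :=
  Iff.rfl

/-- `FgFieldTransferShiftNat p` is v1's field transfer at all finite grades (definitional). [folklore] -/
theorem fgFieldTransferShiftNat_iff (p : ℕ) :
    FgFieldTransferShiftNat p ↔ ∀ d n : ℕ, SpreadOutFgFieldDimLe p d ((n + d : ℕ) : WithBot ℕ∞) n :=
  Iff.rfl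

/-- `FamilyTransferSuccNat p` is v1's family transfer at all finite grades (definitional). [folklore] -/
theorem familyTransferSuccNat_iff (p : ℕ) :
    FamilyTransferSuccNat p ↔ ∀ n : ℕ, SpreadOutRatFuncDimLe p ((n + 1 : ℕ) : WithBot ℕ∞) n :=
  Iff.rfl

/-- v1's `WithBot ℕ∞`-indexed field transfer implies the ℕ-indexed one (pure logic, `Nat.cast_add`). [folklore] -/
theorem fgFieldTransferShiftNat_of_fgFieldTransferShift {p : ℕ} (h : FgFieldTransferShift p) :
    FgFieldTransferShiftNat p :=
  (fgFieldTransferShiftNat_iff p).2 fun d n => by simpa only [Nat.cast_add] using h d n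

/-- v1's `WithBot ℕ∞`-indexed family transfer implies the ℕ-indexed one (pure logic, `Nat.cast_succ`).
[folklore] -/
theorem familyTransferSuccNat_of_familyTransferSucc {p : ℕ} (h : FamilyTransferSucc p) :
    FamilyTransferSuccNat p :=
  (familyTransferSuccNat_iff p).2 fun n => by simpa only [Nat.cast_succ] using h n

/-- The ℕ-indexed field transfer implies the ℕ-indexed family transfer (`d = 1`, `K = RatFunc M`, via v1's
`spreadOutRatFuncDimLe_of_fgField`). [folklore] -/
theorem familyTransferSuccNat_of_fgFieldTransferShiftNat {p : ℕ} (h : FgFieldTransferShiftNat p) :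
    FamilyTransferSuccNat p :=
  (familyTransferSuccNat_iff p).2 fun n => spreadOutRatFuncDimLe_of_fgField ((fgFieldTransferShiftNat_iff p).1 h 1 n)

end Summit.ResolutionOfSingularities.ResolutionOfSingularities.Theorems.CampaignW82

end
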